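import Summits.CriticalPhenomena.PercolationContinuityZ3.Theorems.Transplant.FKConjectureCDefs
import HarnessLib

/-!
# THE 2-POINT-MARGINAL TEST FOR THE PAIR-SQUARE CONE: `InPairSquareCone K → 0 ≤ SR(K; e, f) = Σ_{x ∋ e, y ∋ f} K(x,y)`
# (a necessary condition for `(ID)_J`, any ground type; the functional by which the spikes `S₁₀`, `S₈⁺` refute the all-matroid node)

Claimed R42 (8)(c) in the cell INBOX at 2026-08-29T08:56:30Z by fkp-10a gen 359 (NEW CLAIM #6 of the gen: director-frontier g16′s statement/helper slot (c), cell INBOX l.8807), addressed to coordinator fk-4 gen 294 (seated 06:59Z 2026-08-29 by l.8791; R172–R176 in force; ruling R177 requested); lineage row FO-10a-g359p (self-suggested), package g359-pairmarginal, label PM-A.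
Helper file of the `fk-continuity` build cell (bschramm lane; `--supports stmt-CriticalPhenomena-4575 --as helper`): the reusable part of fk-idea-4
gen 3's `FKPairMarginalSketch.lean` (CARD-3 K2/K3), filed by the lane's ledger writer on director-frontier g16's ruling (cell INBOX l.8807 (c): «the
2-point-marginal test lemma (any α) is a reusable helper ⇒ file as `Theorems/Transplant/FKPairMarginal.lean` WITHOUT the `ConjectureCReg` /
`ConjectureSRReg` defs»); builds on p205010 (kernel theorem, internal audit signed; external expert review pending).  Two definitions with bodies
(the test function and the marginal — computable objects the lane's certificates are read against), no named facts, no conjecture, no sorries, no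
instances, no notation, standard axioms.  NOTHING percolation-bearing follows from this file.

For a kernel `K` on the pair space `Finset α × Finset α` and elements `e, f : α`, the **pair marginal** `SR(K; e, f) := Σ_{x ∋ e} Σ_{y ∋ f} K x y` is
the value of `K` against the test function `Φ = 1{e ∈ x}·1{f ∈ y}`, whose elementary-square increments
`Φ(x,y) + Φ(x+a,y+b) − Φ(x+a,y) − Φ(x,y+b) = (1{e∈x+a} − 1{e∈x})(1{f∈y+b} − 1{f∈y})` are nonnegative; hence every kernel in the square cone
(`FK.InPairSquareCone`, file `FKConjectureCDefs`; 'ID-dominance' `FK.sum_mul_nonneg_of_inPairSquareCone`) has `SR ≥ 0`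
(**`pairMarginal_nonneg_of_inPairSquareCone`**).  Read at `K = conjCKernel M J` this is the pair-marginal necessary condition `SR_J(e,f) ≥ 0` for
`(ID)_J` (`SRNonnegAt`, `srNonnegAt_of_inPairSquareCone`): the functional by which the spikes refute the all-matroid node
(`Theorems/FKConjectureC/Negative/SpikeCounterexample`: `S₁₀ = Z₅∖y₅`, `Σ = −216` IS `SR_0(t, x₅) < 0`).

## References

* D. G. Wagner, *Negatively correlated random variables and Mason's conjecture*, Ann. Comb. 12 (2008) 211–239; arXiv:math/0602648, Thm. 5.8(d),
  §5.3. [Wagner2006]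
* G. Grimmett, *The Random-Cluster Model*, Springer (2006), §3.8 Thm. (3.90), §3.9. [Grimmett2006]
* J. Oxley, *Matroid Theory*, 2nd ed., OUP (2011), §1.3. [Oxley2011]
-/

noncomputable section

namespace Summit.CriticalPhenomena.PercolationContinuityZ3.Theorems

namespace FK

open Finset
open scoped Classical

variable {α : Type*} [Fintype α]

/-- **The test function `1{e ∈ x} · 1{f ∈ y}`** on the pair space. [cite: Wagner2006, Thm. 5.8(d), §5.3] -/
def pairIndicator (e f : α) (x y : Finset α) : ℝ :=
  (if e ∈ x then (1 : ℝ) else 0) * (if f ∈ y then 1 else 0)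

/-- **The 2-point marginal `SR(K; e, f) = Σ_{x ∋ e, y ∋ f} K x y`** of a kernel on the pair space (written as `Σ_{x,y} K x y · 1{e∈x}1{f∈y}`).
[cite: Wagner2006, Thm. 5.8(d), §5.3] -/
def pairMarginal (K : Finset α → Finset α → ℝ) (e f : α) : ℝ :=
  ∑ x : Finset α, ∑ y : Finset α, K x y * pairIndicator e f x y

omit [Fintype α] in
/-- `1{e ∈ s} ≤ 1{e ∈ t}` for `s ⊆ t`. [folklore] -/
theorem ite_mem_le_ite_mem_of_subset {s t : Finset α} (e : α) (hst : s ⊆ t) :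
    (if e ∈ s then (1 : ℝ) else 0) ≤ (if e ∈ t then 1 else 0) := by
  by_cases h : e ∈ s
  · rw [if_pos h, if_pos (hst h)]
  · rw [if_neg h]; split_ifs <;> norm_num

omit [Fintype α] in
/-- **`1{e ∈ x}1{f ∈ y}` has nonnegative elementary-square increments**:
`Φ(x,y) + Φ(x+a,y+b) − Φ(x+a,y) − Φ(x,y+b) = (1{e∈x+a} − 1{e∈x})(1{f∈y+b} − 1{f∈y}) ≥ 0`. [cite: Wagner2006, Thm. 5.8(d), §5.3] -/
theorem pairIndicator_square_nonneg (e f : α) (x y : Finset α) (a b : α) :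
    0 ≤ pairIndicator e f x y + pairIndicator e f (insert a x) (insert b y)
      - pairIndicator e f (insert a x) y - pairIndicator e f x (insert b y) := by
  simp only [pairIndicator]
  have key : ∀ f1 f2 g1 g2 : ℝ, f1 * g1 + f2 * g2 - f2 * g1 - f1 * g2 = (f2 - f1) * (g2 - g1) := by
    intros; ring
  rw [key]
  exact mul_nonneg (sub_nonneg.mpr (ite_mem_le_ite_mem_of_subset e (Finset.subset_insert a x)))
    (sub_nonneg.mpr (ite_mem_le_ite_mem_of_subset f (Finset.subset_insert b y)))

/-- **THE PAIR-MARGINAL TEST: membership in the pair-square cone forces `SR(K; e, f) ≥ 0`** for every `e, f` (ID-dominance against the test function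
`1{e∈x}1{f∈y}`). [cite: Wagner2006, Thm. 5.8(d), §5.3] [cite: Grimmett2006, §3.8 Thm. (3.90)] -/
theorem pairMarginal_nonneg_of_inPairSquareCone {K : Finset α → Finset α → ℝ} (hK : InPairSquareCone K) (e f : α) :
    0 ≤ pairMarginal K e f :=
  sum_mul_nonneg_of_inPairSquareCone hK (pairIndicator e f) (pairIndicator_square_nonneg e f)

/-- **The contrapositive, as used by the refutations**: a kernel with one negative pair marginal is NOT in the square cone.
[cite: Wagner2006, Thm. 5.8(d), §5.3] -/
theorem not_inPairSquareCone_of_pairMarginal_neg {K : Finset α → Finset α → ℝ} {e f : α} (h : pairMarginal K e f < 0) :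
    ¬ InPairSquareCone K := fun hK =>
  (pairMarginal_nonneg_of_inPairSquareCone hK e f).not_gt h

/-- **`(ID)_J` for `M` forces `SR_J(e,f) ≥ 0` for every pair of elements** (`K = conjCKernel M J`; the pair-marginal necessary condition, FK-Q2 §44.2).
[cite: Wagner2006, Thm. 5.8(d), §5.3] [cite: Oxley2011, §1.3] -/
theorem pairMarginal_conjCKernel_nonneg {M : Matroid α} {J : ℕ} (h : InPairSquareCone (conjCKernel M J)) (e f : α) :
    0 ≤ pairMarginal (conjCKernel M J) e f :=
  pairMarginal_nonneg_of_inPairSquareCone h e f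

/-- **Conjecture C on `α` forces every pair marginal of every matroid on `α` at every level to be nonnegative.** [cite: Oxley2011, §1.3] -/
theorem pairMarginal_conjCKernel_nonneg_of_conjectureCOn (h : ConjectureCOn α) (M : Matroid α) (J : ℕ) (e f : α) :
    0 ≤ pairMarginal (conjCKernel M J) e f :=
  pairMarginal_nonneg_of_inPairSquareCone (h M J) e f

end FK

end Summit.CriticalPhenomena.PercolationContinuityZ3.Theorems
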